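import Summits.CriticalPhenomena.PercolationContinuityZ3.Theorems.Transplant.PlanarSkeletonFrmQuasiDefs
import Summits.CriticalPhenomena.PercolationContinuityZ3.Theorems.Transplant.SkelFrmQuasiBChoiceRootBoxX
import Summits.CriticalPhenomena.PercolationContinuityZ3.Theorems.Transplant.SkelFrmBChoiceRootBoxX
import Summits.CriticalPhenomena.PercolationContinuityZ3.Theorems.Transplant.SkelFrmQuasiBChoiceRootBoxY
import Summits.CriticalPhenomena.PercolationContinuityZ3.Theorems.Transplant.SkelFrmBChoiceRootBoxY
import Summits.CriticalPhenomena.PercolationContinuityZ3.Theorems.Transplant.SkelFrmQuasiBChoiceRootLanding2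
import Summits.CriticalPhenomena.PercolationContinuityZ3.Theorems.Transplant.SkelFrmBChoiceRootLanding2
import Summits.CriticalPhenomena.PercolationContinuityZ3.Theorems.Transplant.SkelFrmQuasiBChoiceRootDepthR
import Summits.CriticalPhenomena.PercolationContinuityZ3.Theorems.Transplant.SkelFrmBChoiceRootDepthR
import Summits.CriticalPhenomena.PercolationContinuityZ3.Theorems.Transplant.SkelPhiCorridorKGMono
import Summits.CriticalPhenomena.PercolationContinuityZ3.Theorems.Transplant.SkelPhiCorridorKGPrism
import Summits.CriticalPhenomena.PercolationContinuityZ3.Theorems.Transplant.SkelPhiNegReachRoomsRead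
import Summits.CriticalPhenomena.PercolationContinuityZ3.Theorems.Transplant.SkelFrmQuasiBChoiceReadings
import Summits.CriticalPhenomena.PercolationContinuityZ3.Theorems.Transplant.SkelFrmBChoiceReadings
import Summits.CriticalPhenomena.PercolationContinuityZ3.Theorems.Transplant.SkelPhiRootChainNT
import Summits.CriticalPhenomena.PercolationContinuityZ3.Theorems.Transplant.SkelFrmQuasiBChoiceDefsT
import Summits.CriticalPhenomena.PercolationContinuityZ3.Theorems.Transplant.SkelFrmBChoiceDefsT
import Summits.CriticalPhenomena.PercolationContinuityZ3.Theorems.Transplant.SkelFrmQuasi1ChoiceDefs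
import Summits.CriticalPhenomena.PercolationContinuityZ3.Theorems.Transplant.SkelFrmQuasi1ParamsLBL
import Summits.CriticalPhenomena.PercolationContinuityZ3.Theorems.Transplant.SkelFrmQuasi1ParamsPO
import Summits.CriticalPhenomena.PercolationContinuityZ3.Theorems.Transplant.SkelFrmQuasiBChoiceNums
import Summits.CriticalPhenomena.PercolationContinuityZ3.Theorems.Transplant.SkelFrmQuasiBChoiceRootLanding
import Summits.CriticalPhenomena.PercolationContinuityZ3.Theorems.Transplant.SkelFrmQuasiBChoiceRootRun
import Summits.CriticalPhenomena.PercolationContinuityZ3.Theorems.Transplant.SkelFrmQuasiBParamsBridge0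
import Summits.CriticalPhenomena.PercolationContinuityZ3.Theorems.Transplant.SkelFrmQuasiBParamsCorrKG
import Summits.CriticalPhenomena.PercolationContinuityZ3.Theorems.Transplant.SkelFrmQuasiBParamsCorrKG0
import Summits.CriticalPhenomena.PercolationContinuityZ3.Theorems.Transplant.SkelFrmQuasiBParamsCorrKGLen3
import Summits.CriticalPhenomena.PercolationContinuityZ3.Theorems.Transplant.SkelFrmQuasiBParamsLF
import Summits.CriticalPhenomena.PercolationContinuityZ3.Theorems.Transplant.SkelFrmQuasiBParamsLFA
import Summits.CriticalPhenomena.PercolationContinuityZ3.Theorems.Transplant.SkelFrmQuasiBParamsSchedA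
import HarnessLib
import Summits.CriticalPhenomena.PercolationContinuityZ3.Theorems.Transplant.SkelFrmBChoiceRootReadX
/-!
# GEN-Q PORT (WAVE-Q table v0.8 section 2, row G167, U-level L?; captain R-6/R-7 2026-08-27: carrier token swap `PlanarSkeletonFrmFrom ↦ PlanarSkeletonFrmQuasi`)
# of the tree module «Transplant/SkelFrmFromBChoiceRootReadX» (sha256 2a6061ae4de0b742…) onto the quasi-step carrier `PlanarSkeletonFrmQuasi` (p507026): «SkelFrmQuasiBChoiceRootReadX»

ORIGINAL TITLE: N2 (frames-only node `SamePDropOfSkeletonFrm₁`, OPEN), (R) column, reading rows: **THE FIRST-AXIS ROOT SETS IN `t`-FRAME BOXES** —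

builds on p205010 (kernel theorem, internal audit signed; external expert review pending) — nothing in this file uses p205010; NOTHING is claimed about any open node
((N3-b), the end state).  Lane `prim-bschramm`, seat `prim-hp-8` (gen 62; GEN-Q pen, family BChoiceRoot*/1Root*/BParamsKit·Bridge; tool = captain gen-1 g4's port_genq.py R-14 + p3-g30 T1/T2 + stmt-g33 --force-keep).  Helper file (`--supports stmt-CriticalPhenomena-4575 --as helper`).
PORT RULES (U-wave r1–r4 re-used, GEN-Q hunk classes of p3-g29 #6136): declaration order, names and proof texts are those of «SkelFrmFromBChoiceRootReadX», byte-identical except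
(i) the carrier token `PlanarSkeletonFrmFrom ↦ PlanarSkeletonFrmQuasi` in binders, `namespace`/`end` lines and qualified names (module names `SkelFrmFrom… ↦ SkelFrmQuasi…`
in imports of already-ported rows); (ii) `Φ.step ↦ Φ.qstep` with the called Steps lemma replaced by its `…Q`/`_q` twin and the cost `Φ.M` threaded (none in this file unless
listed below); (iii) `Φ.cyl_connected ↦ Φ.cyl_reach` readers (none unless listed); (iv) graph-ball radii / window floors ×`Φ.M` (none unless listed).  HAND HUNK (L-KitS-1 / L-FLOORMAP-1 ⑧): the kit's R′ is read at the window cost of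
record — `KS0.R'0 κ Φ t p D mk ↦ KS0.R'0N κ Φ (KS.NQ Φ) t p D mk` (stmt-g33's G017 «SkelFrmQuasiBChoiceNums», hp-8's «SkelFrmQuasiBParamsKitSN»).  Carrier-free
residents stay imported/exported from the original «SkelFrmBChoiceRootReadX» exactly as in the FrmFrom port.  Docstrings and citations are the original's.

-/

noncomputable section

open scoped Classical

namespace Summit.CriticalPhenomena.PercolationContinuityZ3.Theorems.Transplant

open MeasureTheory Literature.Probability.Percolation Literature.Probability.LatticeModels SimpleGraph KNCells KNLevels ChainPlanar ChainPara
open Literature.Probability.Percolation.KozmaNitzan.Cells (oth sgOf)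
open Literature.Barriers.CriticalPhenomena (graphBall)
open SkelConc (Consts)
open Skelφ (rootFrame RootFootT TargetFootT shearUnit kgSL kgZ₀ kgZ₁ kgM₁ kgM₂ kgWm₂ kgWp₂ kgA₁ kgFar rdLo rdHi KGRows)
open TwoAxis.Para (modulus)
open ChainPlanar (ScheduleNP BridgePrm)

namespace PlanarSkeletonFrmQuasi

namespace NegB

open Neg

namespace KS

section ReadX

variable (κ : Consts) {V : Type} [DecidableEq V] [Countable V] {G : SimpleGraph V} [G.LocallyFinite] (Φ : PlanarSkeletonFrmQuasi G) (t : V) (p : unitInterval)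
  (D : Skelφ.StepI.DataNS V) (mk g f qx Wx : ℕ) (c : Fin 2 → ℕ)

/-! ## §0 The fine reading of a `t`-frame box -/

/-- **A point whose `t`-run coordinates lie in `[lo, hi]` reads within `[rdLo, rdHi] (lo, hi)`** (origin `t`: `fineA … t = 0 = cen 0`). [folklore] -/
theorem fine_mem_rd_root (κ : Consts) {V : Type} [DecidableEq V] [Countable V] {G : SimpleGraph V} [G.LocallyFinite] (Φ : PlanarSkeletonFrmQuasi G) (t : V) (p : unitInterval) (D : Skelφ.StepI.DataNS V) (g : ℕ) (f : ℕ) (hN : EqNumL κ Φ t p D g f) {φ' : V → Site 2} {lo hi : Site 2} {w : V}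
    (hw : Skelφ.runX φ' t (nL κ Φ t p D g f) (hL κ Φ t p D g f) 1 w ∈ Finset.Icc lo hi) (i : Fin 2) :
    rdLo (Aof κ) (nL κ Φ t p D g f) (hL κ Φ t p D g f) (vL κ Φ t p D g f) (vβL κ Φ t p D g f) (prFA κ Φ t p D g f).c₀ (prFA κ Φ t p D g f).c₁
        (prFA κ Φ t p D g f).D lo hi i ≤ fineA κ Φ t p D g f φ' w i ∧
      fineA κ Φ t p D g f φ' w i ≤ rdHi (Aof κ) (nL κ Φ t p D g f) (hL κ Φ t p D g f) (vL κ Φ t p D g f) (vβL κ Φ t p D g f) (prFA κ Φ t p D g f).c₀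
        (prFA κ Φ t p D g f).c₁ (prFA κ Φ t p D g f).D lo hi i := by
  obtain ⟨-, -, hn1, hA0, hDp, hm, hc₀, hc₁, -, -⟩ := hsc_Q κ Φ t p D g f hN
  have hcen : Skelφ.fineSkel φ' t (Aof κ) (nL κ Φ t p D g f) (hL κ Φ t p D g f) (vL κ Φ t p D g f) (vβL κ Φ t p D g f) (prFA κ Φ t p D g f).c₀
      (prFA κ Φ t p D g f).c₁ ((prFA κ Φ t p D g f).D / 2) ((prFA κ Φ t p D g f).D / 2) (prFA κ Φ t p D g f).D t = (fcellsA κ Φ t p D g f).cen 0 := by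
    rw [PCells2.cen_zero]
    exact fineA_base_at κ Φ t p D g f φ' hN
  have h := Skelφ.fine_sub_cen_mem_rd hA0.le hn1 hm.le hc₀.le hc₁.le hDp hcen hw i
  simp only [PCells2.cen_zero, Pi.zero_apply, sub_zero] at h
  exact h

/-! ## §1 The root corridor's regions in one `t`-frame box -/

set_option maxHeartbeats 1600000 in
/-- **Every region of the root corridor, read in the `t`-frame, lies in any box `[lo, hi]` enclosing `[(−Z₀, −(Z₁ + sL)), ((N+1)n_L + Z₀ + 4n_L + qx,
Z₁ + sL)]`** (Z's and `N` at `kgNv0`). [this work] -/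
theorem rootRegion_mem_box (κ : Consts) {V : Type} [DecidableEq V] [Countable V] {G : SimpleGraph V} [G.LocallyFinite] (Φ : PlanarSkeletonFrmQuasi G) (t : V) (p : unitInterval) (D : Skelφ.StepI.DataNS V) (mk : ℕ) (g : ℕ) (f : ℕ) (qx : ℕ) (Wx : ℕ) (hN : EqNumL κ Φ t p D g f) (hg : gFloorKG κ Φ t p D mk ≤ g) (hg2 : 40 * Neg.K κ * KS0.R'0N κ Φ (KS.NQ Φ) t p D mk ≤ g)
    (hqx : qx ≤ 100 * nL κ Φ t p D g f) (hWx : (Wx : ℤ) ≤ 20 * (kgSL (nL κ Φ t p D g f) (ℓL κ Φ t p D g f) (hL κ Φ t p D g f))) (hf : KS.fxR0 κ Φ t p D mk ≤ f)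
    {φ' : V → Site 2} {c₁ : V} (hX : φ' c₁ 0 - φ' t 0 = X1 κ Φ t p D mk g f (kgq κ Φ t p D g f qx)) (hY : φ' c₁ 1 - φ' t 1 = Y1s κ Φ t p D mk g f (kgq κ Φ t p D g f qx))
    {lo hi : Site 2}
    (hlo0 : lo 0 ≤ -kgZ₀ (nL κ Φ t p D g f) (vL κ Φ t p D g f) (kgR κ Φ t p D mk) 0 (kgq κ Φ t p D g f qx) (kgNv0 κ Φ t p D g f mk qx Wx)
      (kgM₁ (nL κ Φ t p D g f) (ℓL κ Φ t p D g f) (hL κ Φ t p D g f) (kgR κ Φ t p D mk) 0 (kgW κ Φ t p D g f Wx) (kgNv0 κ Φ t p D g f mk qx Wx))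
      (kgM₂ (nL κ Φ t p D g f) (ℓL κ Φ t p D g f) (hL κ Φ t p D g f) (vL κ Φ t p D g f) (kgR κ Φ t p D mk) 0 (kgq κ Φ t p D g f qx) (kgW κ Φ t p D g f Wx) (kgNv0 κ Φ t p D g f mk qx Wx)))
    (hhi0 : ((((kgNv0 κ Φ t p D g f mk qx Wx) : ℕ) : ℤ) + 1) * (nL κ Φ t p D g f : ℤ) +
      kgZ₀ (nL κ Φ t p D g f) (vL κ Φ t p D g f) (kgR κ Φ t p D mk) 0 (kgq κ Φ t p D g f qx) (kgNv0 κ Φ t p D g f mk qx Wx)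
        (kgM₁ (nL κ Φ t p D g f) (ℓL κ Φ t p D g f) (hL κ Φ t p D g f) (kgR κ Φ t p D mk) 0 (kgW κ Φ t p D g f Wx) (kgNv0 κ Φ t p D g f mk qx Wx))
        (kgM₂ (nL κ Φ t p D g f) (ℓL κ Φ t p D g f) (hL κ Φ t p D g f) (vL κ Φ t p D g f) (kgR κ Φ t p D mk) 0 (kgq κ Φ t p D g f qx) (kgW κ Φ t p D g f Wx) (kgNv0 κ Φ t p D g f mk qx Wx)) +
      4 * (nL κ Φ t p D g f : ℤ) + qx ≤ hi 0)
    (hlo1 : lo 1 ≤ -(kgZ₁ (nL κ Φ t p D g f) (ℓL κ Φ t p D g f) (hL κ Φ t p D g f) (kgR κ Φ t p D mk) 0 (kgW κ Φ t p D g f Wx) (kgNv0 κ Φ t p D g f mk qx Wx)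
      (kgM₁ (nL κ Φ t p D g f) (ℓL κ Φ t p D g f) (hL κ Φ t p D g f) (kgR κ Φ t p D mk) 0 (kgW κ Φ t p D g f Wx) (kgNv0 κ Φ t p D g f mk qx Wx))
      (kgWm₂ (nL κ Φ t p D g f) (ℓL κ Φ t p D g f) (hL κ Φ t p D g f) (kgR κ Φ t p D mk) 0 (kgW κ Φ t p D g f Wx) (kgNv0 κ Φ t p D g f mk qx Wx))
      (kgWp₂ (nL κ Φ t p D g f) (ℓL κ Φ t p D g f) (hL κ Φ t p D g f) (kgR κ Φ t p D mk) 0 (kgW κ Φ t p D g f Wx) (kgNv0 κ Φ t p D g f mk qx Wx))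
      (kgM₂ (nL κ Φ t p D g f) (ℓL κ Φ t p D g f) (hL κ Φ t p D g f) (vL κ Φ t p D g f) (kgR κ Φ t p D mk) 0 (kgq κ Φ t p D g f qx) (kgW κ Φ t p D g f Wx) (kgNv0 κ Φ t p D g f mk qx Wx)) +
      kgSL (nL κ Φ t p D g f) (ℓL κ Φ t p D g f) (hL κ Φ t p D g f)))
    (hhi1 : kgZ₁ (nL κ Φ t p D g f) (ℓL κ Φ t p D g f) (hL κ Φ t p D g f) (kgR κ Φ t p D mk) 0 (kgW κ Φ t p D g f Wx) (kgNv0 κ Φ t p D g f mk qx Wx)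
      (kgM₁ (nL κ Φ t p D g f) (ℓL κ Φ t p D g f) (hL κ Φ t p D g f) (kgR κ Φ t p D mk) 0 (kgW κ Φ t p D g f Wx) (kgNv0 κ Φ t p D g f mk qx Wx))
      (kgWm₂ (nL κ Φ t p D g f) (ℓL κ Φ t p D g f) (hL κ Φ t p D g f) (kgR κ Φ t p D mk) 0 (kgW κ Φ t p D g f Wx) (kgNv0 κ Φ t p D g f mk qx Wx))
      (kgWp₂ (nL κ Φ t p D g f) (ℓL κ Φ t p D g f) (hL κ Φ t p D g f) (kgR κ Φ t p D mk) 0 (kgW κ Φ t p D g f Wx) (kgNv0 κ Φ t p D g f mk qx Wx))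
      (kgM₂ (nL κ Φ t p D g f) (ℓL κ Φ t p D g f) (hL κ Φ t p D g f) (vL κ Φ t p D g f) (kgR κ Φ t p D mk) 0 (kgq κ Φ t p D g f qx) (kgW κ Φ t p D g f Wx) (kgNv0 κ Φ t p D g f mk qx Wx)) +
      kgSL (nL κ Φ t p D g f) (ℓL κ Φ t p D g f) (hL κ Φ t p D g f) ≤ hi 1)
    {k : ℕ} (hk : k ≤ (Skelφ.kgCorrSched ((kgRows0_of κ Φ t p D g f mk qx Wx hN hg).kgVals_ok₁ (KS.kgNR κ Φ t p D mk g f qx Wx)) ((kgRows0_of κ Φ t p D g f mk qx Wx hN hg).kgVals_ok₂ (KS.kgNR κ Φ t p D mk g f qx Wx)) ((kgRows0_of κ Φ t p D g f mk qx Wx hN hg).kgVals_split (KS.kgNR κ Φ t p D mk g f qx Wx))).N)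
    {w : V} (hw : Skelφ.runX φ' c₁ (nL κ Φ t p D g f) (hL κ Φ t p D g f) 1 w ∈ (Skelφ.kgCorrSched ((kgRows0_of κ Φ t p D g f mk qx Wx hN hg).kgVals_ok₁ (KS.kgNR κ Φ t p D mk g f qx Wx)) ((kgRows0_of κ Φ t p D g f mk qx Wx hN hg).kgVals_ok₂ (KS.kgNR κ Φ t p D mk g f qx Wx)) ((kgRows0_of κ Φ t p D g f mk qx Wx hN hg).kgVals_split (KS.kgNR κ Φ t p D mk g f qx Wx))).region k) :
    Skelφ.runX φ' t (nL κ Φ t p D g f) (hL κ Φ t p D g f) 1 w ∈ Finset.Icc lo hi := by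
  have H := kgRows0_of κ Φ t p D g f mk qx Wx hN hg
  have hn1 := (one_le_of_eqNumL κ Φ t p D g f hN).1
  have hle := kgNR_le_kgNv0 κ Φ t p D mk g f qx Wx hN hg hg2 hqx hWx hf
  -- the region inside the prism box at `N_R`
  have hp := Skelφ.kgCorrSched_region_subset_prism (H.kgVals_ok₁ (KS.kgNR κ Φ t p D mk g f qx Wx)) (H.kgVals_ok₂ (KS.kgNR κ Φ t p D mk g f qx Wx))
    (H.kgVals_split (KS.kgNR κ Φ t p D mk g f qx Wx)) hk hw
  obtain ⟨b1, b2, b3, b4⟩ := Skelφ.mem_kgCorrSched_prism_box (H.kgVals_ok₁ (KS.kgNR κ Φ t p D mk g f qx Wx)) (H.kgVals_ok₂ (KS.kgNR κ Φ t p D mk g f qx Wx))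
    (H.kgVals_split (KS.kgNR κ Φ t p D mk g f qx Wx)) hp
  -- monotonicity `N_R ≤ kgNv0`
  have hZ₀ := H.kgZ₀_mono hle
  have hZ₁ := H.kgZ₁_le_add_of_le hle
  have hd : Skelφ.kgDec₁ (nL κ Φ t p D g f) (ℓL κ Φ t p D g f) (hL κ Φ t p D g f) (kgR κ Φ t p D mk) 0 ≤ kgSL (nL κ Φ t p D g f) (ℓL κ Φ t p D g f) (hL κ Φ t p D g f) := by
    unfold Skelφ.kgDec₁; have : (0 : ℤ) ≤ (((kgR κ Φ t p D mk) : ℕ) : ℤ) := by positivity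
    push_cast; linarith
  have hNle : (((KS.kgNR κ Φ t p D mk g f qx Wx : ℕ)) : ℤ) ≤ ((kgNv0 κ Φ t p D g f mk qx Wx : ℕ) : ℤ) := by exact_mod_cast hle
  have hn0 : (0 : ℤ) ≤ (nL κ Φ t p D g f : ℤ) := by positivity
  have hNn := mul_le_mul_of_nonneg_right hNle hn0
  -- `X1 ≤ 4n + qx`, `0 ≤ X1`
  obtain ⟨hX1lo, hX1hi⟩ := X1_bounds κ Φ t p D mk g f qx hf
  have hRs0 : (0 : ℤ) ≤ ((KS.Rs t D mk : ℕ) : ℤ) := by positivity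
  have hR0 : (0 : ℤ) ≤ (KS0.R'0N κ Φ (KS.NQ Φ) t p D mk : ℤ) := by positivity
  -- the shift to the `t`-frame
  obtain ⟨hr0, hrn, -⟩ := rows_c₁s_zero κ Φ t p D mk g f (kgq κ Φ t p D g f qx) hN
  have hU : (nL κ Φ t p D g f : ℤ) ≤ (shearUnit (nL κ Φ t p D g f) (hL κ Φ t p D g f) : ℤ) := by
    unfold Skelφ.shearUnit; push_cast; linarith [abs_nonneg (hL κ Φ t p D g f), (Int.natCast_natAbs (hL κ Φ t p D g f)).le]
  have hbox : Skelφ.runX φ' c₁ (nL κ Φ t p D g f) (hL κ Φ t p D g f) 1 w ∈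
      Finset.Icc (![-kgZ₀ (nL κ Φ t p D g f) (vL κ Φ t p D g f) (kgR κ Φ t p D mk) 0 (kgq κ Φ t p D g f qx) (KS.kgNR κ Φ t p D mk g f qx Wx)
          (kgM₁ (nL κ Φ t p D g f) (ℓL κ Φ t p D g f) (hL κ Φ t p D g f) (kgR κ Φ t p D mk) 0 (kgW κ Φ t p D g f Wx) (KS.kgNR κ Φ t p D mk g f qx Wx))
          (kgM₂ (nL κ Φ t p D g f) (ℓL κ Φ t p D g f) (hL κ Φ t p D g f) (vL κ Φ t p D g f) (kgR κ Φ t p D mk) 0 (kgq κ Φ t p D g f qx) (kgW κ Φ t p D g f Wx) (KS.kgNR κ Φ t p D mk g f qx Wx)),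
        -kgZ₁ (nL κ Φ t p D g f) (ℓL κ Φ t p D g f) (hL κ Φ t p D g f) (kgR κ Φ t p D mk) 0 (kgW κ Φ t p D g f Wx) (KS.kgNR κ Φ t p D mk g f qx Wx)
          (kgM₁ (nL κ Φ t p D g f) (ℓL κ Φ t p D g f) (hL κ Φ t p D g f) (kgR κ Φ t p D mk) 0 (kgW κ Φ t p D g f Wx) (KS.kgNR κ Φ t p D mk g f qx Wx))
          (kgWm₂ (nL κ Φ t p D g f) (ℓL κ Φ t p D g f) (hL κ Φ t p D g f) (kgR κ Φ t p D mk) 0 (kgW κ Φ t p D g f Wx) (KS.kgNR κ Φ t p D mk g f qx Wx))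
          (kgWp₂ (nL κ Φ t p D g f) (ℓL κ Φ t p D g f) (hL κ Φ t p D g f) (kgR κ Φ t p D mk) 0 (kgW κ Φ t p D g f Wx) (KS.kgNR κ Φ t p D mk g f qx Wx))
          (kgM₂ (nL κ Φ t p D g f) (ℓL κ Φ t p D g f) (hL κ Φ t p D g f) (vL κ Φ t p D g f) (kgR κ Φ t p D mk) 0 (kgq κ Φ t p D g f qx) (kgW κ Φ t p D g f Wx) (KS.kgNR κ Φ t p D mk g f qx Wx))])
        (![((((KS.kgNR κ Φ t p D mk g f qx Wx) : ℕ) : ℤ) + 1) * (nL κ Φ t p D g f : ℤ) +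
          kgZ₀ (nL κ Φ t p D g f) (vL κ Φ t p D g f) (kgR κ Φ t p D mk) 0 (kgq κ Φ t p D g f qx) (KS.kgNR κ Φ t p D mk g f qx Wx)
            (kgM₁ (nL κ Φ t p D g f) (ℓL κ Φ t p D g f) (hL κ Φ t p D g f) (kgR κ Φ t p D mk) 0 (kgW κ Φ t p D g f Wx) (KS.kgNR κ Φ t p D mk g f qx Wx))
            (kgM₂ (nL κ Φ t p D g f) (ℓL κ Φ t p D g f) (hL κ Φ t p D g f) (vL κ Φ t p D g f) (kgR κ Φ t p D mk) 0 (kgq κ Φ t p D g f qx) (kgW κ Φ t p D g f Wx) (KS.kgNR κ Φ t p D mk g f qx Wx)),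
        kgZ₁ (nL κ Φ t p D g f) (ℓL κ Φ t p D g f) (hL κ Φ t p D g f) (kgR κ Φ t p D mk) 0 (kgW κ Φ t p D g f Wx) (KS.kgNR κ Φ t p D mk g f qx Wx)
          (kgM₁ (nL κ Φ t p D g f) (ℓL κ Φ t p D g f) (hL κ Φ t p D g f) (kgR κ Φ t p D mk) 0 (kgW κ Φ t p D g f Wx) (KS.kgNR κ Φ t p D mk g f qx Wx))
          (kgWm₂ (nL κ Φ t p D g f) (ℓL κ Φ t p D g f) (hL κ Φ t p D g f) (kgR κ Φ t p D mk) 0 (kgW κ Φ t p D g f Wx) (KS.kgNR κ Φ t p D mk g f qx Wx))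
          (kgWp₂ (nL κ Φ t p D g f) (ℓL κ Φ t p D g f) (hL κ Φ t p D g f) (kgR κ Φ t p D mk) 0 (kgW κ Φ t p D g f Wx) (KS.kgNR κ Φ t p D mk g f qx Wx))
          (kgM₂ (nL κ Φ t p D g f) (ℓL κ Φ t p D g f) (hL κ Φ t p D g f) (vL κ Φ t p D g f) (kgR κ Φ t p D mk) 0 (kgq κ Φ t p D g f qx) (kgW κ Φ t p D g f Wx) (KS.kgNR κ Φ t p D mk g f qx Wx))]) := by
    rw [Finset.mem_Icc, Pi.le_def, Pi.le_def, Fin.forall_fin_two, Fin.forall_fin_two]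
    simp only [Matrix.cons_val_zero, Matrix.cons_val_one, Matrix.cons_val_fin_one]
    exact ⟨⟨b1, b3⟩, b2, b4⟩
  have hsh := Skelφ.runX_shift_mem_Icc t c₁ (nL κ Φ t p D g f) hn1 (hL κ Φ t p D g f) hX hY hr0 (lt_of_lt_of_le hrn hU) hbox
  rw [Finset.mem_Icc, Pi.le_def, Pi.le_def, Fin.forall_fin_two, Fin.forall_fin_two] at hsh ⊢
  simp only [Pi.add_apply, Matrix.cons_val_zero, Matrix.cons_val_one, Matrix.cons_val_fin_one] at hsh
  obtain ⟨⟨h0, h1⟩, h2, h3⟩ := hsh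
  refine ⟨⟨by linarith, by linarith⟩, by nlinarith, by linarith⟩

/-! ## §2 The bridge region in the same box -/

set_option maxHeartbeats 1600000 in
/-- **The bridge region `[B0.regionLo, B0.regionHi]` (root frame), read in the `t`-run frame, lies in any box `[lo, hi]` as in §1** (it sits at
`x ∈ n_L ± (R′0 + prB0)`, rows `∈ [−(R′0 + prB0), nℓ/U + R′0 + prB0]`; needs `2f + 5R′0 + 3 ≤ g` for `f < n_L/2` and `sL ≥ g − 1`). [this work] -/
theorem bridgeRegion_mem_box (κ : Consts) {V : Type} [DecidableEq V] [Countable V] {G : SimpleGraph V} [G.LocallyFinite] (Φ : PlanarSkeletonFrmQuasi G) (t : V) (p : unitInterval) (D : Skelφ.StepI.DataNS V) (mk : ℕ) (g : ℕ) (f : ℕ) (qx : ℕ) (Wx : ℕ) (hN : EqNumL κ Φ t p D g f)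
    (hf : KS.fxR0 κ Φ t p D mk ≤ f) (hfg : 2 * f + 5 * KS0.R'0N κ Φ (KS.NQ Φ) t p D mk + 3 ≤ g)
    {φ' : V → Site 2} {lo hi : Site 2}
    (hlo0 : lo 0 ≤ -kgZ₀ (nL κ Φ t p D g f) (vL κ Φ t p D g f) (kgR κ Φ t p D mk) 0 (kgq κ Φ t p D g f qx) (kgNv0 κ Φ t p D g f mk qx Wx)
      (kgM₁ (nL κ Φ t p D g f) (ℓL κ Φ t p D g f) (hL κ Φ t p D g f) (kgR κ Φ t p D mk) 0 (kgW κ Φ t p D g f Wx) (kgNv0 κ Φ t p D g f mk qx Wx))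
      (kgM₂ (nL κ Φ t p D g f) (ℓL κ Φ t p D g f) (hL κ Φ t p D g f) (vL κ Φ t p D g f) (kgR κ Φ t p D mk) 0 (kgq κ Φ t p D g f qx) (kgW κ Φ t p D g f Wx) (kgNv0 κ Φ t p D g f mk qx Wx)))
    (hhi0 : ((((kgNv0 κ Φ t p D g f mk qx Wx) : ℕ) : ℤ) + 1) * (nL κ Φ t p D g f : ℤ) +
      kgZ₀ (nL κ Φ t p D g f) (vL κ Φ t p D g f) (kgR κ Φ t p D mk) 0 (kgq κ Φ t p D g f qx) (kgNv0 κ Φ t p D g f mk qx Wx)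
        (kgM₁ (nL κ Φ t p D g f) (ℓL κ Φ t p D g f) (hL κ Φ t p D g f) (kgR κ Φ t p D mk) 0 (kgW κ Φ t p D g f Wx) (kgNv0 κ Φ t p D g f mk qx Wx))
        (kgM₂ (nL κ Φ t p D g f) (ℓL κ Φ t p D g f) (hL κ Φ t p D g f) (vL κ Φ t p D g f) (kgR κ Φ t p D mk) 0 (kgq κ Φ t p D g f qx) (kgW κ Φ t p D g f Wx) (kgNv0 κ Φ t p D g f mk qx Wx)) +
      4 * (nL κ Φ t p D g f : ℤ) + qx ≤ hi 0)
    (hlo1 : lo 1 ≤ -(kgZ₁ (nL κ Φ t p D g f) (ℓL κ Φ t p D g f) (hL κ Φ t p D g f) (kgR κ Φ t p D mk) 0 (kgW κ Φ t p D g f Wx) (kgNv0 κ Φ t p D g f mk qx Wx)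
      (kgM₁ (nL κ Φ t p D g f) (ℓL κ Φ t p D g f) (hL κ Φ t p D g f) (kgR κ Φ t p D mk) 0 (kgW κ Φ t p D g f Wx) (kgNv0 κ Φ t p D g f mk qx Wx))
      (kgWm₂ (nL κ Φ t p D g f) (ℓL κ Φ t p D g f) (hL κ Φ t p D g f) (kgR κ Φ t p D mk) 0 (kgW κ Φ t p D g f Wx) (kgNv0 κ Φ t p D g f mk qx Wx))
      (kgWp₂ (nL κ Φ t p D g f) (ℓL κ Φ t p D g f) (hL κ Φ t p D g f) (kgR κ Φ t p D mk) 0 (kgW κ Φ t p D g f Wx) (kgNv0 κ Φ t p D g f mk qx Wx))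
      (kgM₂ (nL κ Φ t p D g f) (ℓL κ Φ t p D g f) (hL κ Φ t p D g f) (vL κ Φ t p D g f) (kgR κ Φ t p D mk) 0 (kgq κ Φ t p D g f qx) (kgW κ Φ t p D g f Wx) (kgNv0 κ Φ t p D g f mk qx Wx)) +
      kgSL (nL κ Φ t p D g f) (ℓL κ Φ t p D g f) (hL κ Φ t p D g f)))
    (hhi1 : kgZ₁ (nL κ Φ t p D g f) (ℓL κ Φ t p D g f) (hL κ Φ t p D g f) (kgR κ Φ t p D mk) 0 (kgW κ Φ t p D g f Wx) (kgNv0 κ Φ t p D g f mk qx Wx)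
      (kgM₁ (nL κ Φ t p D g f) (ℓL κ Φ t p D g f) (hL κ Φ t p D g f) (kgR κ Φ t p D mk) 0 (kgW κ Φ t p D g f Wx) (kgNv0 κ Φ t p D g f mk qx Wx))
      (kgWm₂ (nL κ Φ t p D g f) (ℓL κ Φ t p D g f) (hL κ Φ t p D g f) (kgR κ Φ t p D mk) 0 (kgW κ Φ t p D g f Wx) (kgNv0 κ Φ t p D g f mk qx Wx))
      (kgWp₂ (nL κ Φ t p D g f) (ℓL κ Φ t p D g f) (hL κ Φ t p D g f) (kgR κ Φ t p D mk) 0 (kgW κ Φ t p D g f Wx) (kgNv0 κ Φ t p D g f mk qx Wx))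
      (kgM₂ (nL κ Φ t p D g f) (ℓL κ Φ t p D g f) (hL κ Φ t p D g f) (vL κ Φ t p D g f) (kgR κ Φ t p D mk) 0 (kgq κ Φ t p D g f qx) (kgW κ Φ t p D g f Wx) (kgNv0 κ Φ t p D g f mk qx Wx)) +
      kgSL (nL κ Φ t p D g f) (ℓL κ Φ t p D g f) (hL κ Φ t p D g f) ≤ hi 1)
    {w : V} (hw : rootFrame φ' t 1 w ∈ Finset.Icc (B0 κ Φ t p D mk g f).regionLo (B0 κ Φ t p D mk g f).regionHi) :
    Skelφ.runX φ' t (nL κ Φ t p D g f) (hL κ Φ t p D g f) 1 w ∈ Finset.Icc lo hi := by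
  have hn1 := (one_le_of_eqNumL κ Φ t p D g f hN).1
  have hn0 : (0 : ℤ) < (nL κ Φ t p D g f : ℤ) := by exact_mod_cast hn1
  -- the bridge region's corners
  obtain ⟨e0, e1, e2, e3, e4, -, -, -, -, e9⟩ := B0_apply κ Φ t p D mk g f
  rw [Finset.mem_Icc, Pi.le_def, Pi.le_def, Fin.forall_fin_two, Fin.forall_fin_two] at hw
  simp only [BridgePrm.regionLo, BridgePrm.regionHi, Pi.sub_apply, Pi.add_apply, Pi.natCast_apply, e0, e1, e2, e3, e4, e9] at hw
  obtain ⟨⟨hx0, hy0⟩, hx1, hy1⟩ := hw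
  have hrf0 : rootFrame φ' t 1 w 0 = φ' w 0 - φ' t 0 := by
    show (if (0 : Fin 2) = 0 then (1 : ℤ) * (φ' w 0 - φ' t 0) else φ' w 1 - φ' t 1) = _; rw [if_pos rfl, one_mul]
  have hrf1 : rootFrame φ' t 1 w 1 = φ' w 1 - φ' t 1 := by
    show (if (1 : Fin 2) = 0 then (1 : ℤ) * (φ' w 0 - φ' t 0) else φ' w 1 - φ' t 1) = _; rw [if_neg (by decide)]
  rw [hrf0] at hx0 hx1
  rw [hrf1] at hy0 hy1
  -- sizes: `pr + R' ≤ f`, `2f + 5R' + 3 ≤ g ≤ M_L ≤ sL + 1`, `M_L < n_L`, nonnegativity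
  have hpr : ((prB0 κ Φ t p D mk : ℕ) : ℤ) + (KS0.R'0N κ Φ (KS.NQ Φ) t p D mk : ℤ) + 1 ≤ (f : ℤ) := by
    have h := hf; rw [fxR0_eq] at h; zify at h; linarith [(by positivity : (0 : ℤ) ≤ ((KS.Rs t D mk : ℕ) : ℤ))]
  have hgf : 2 * (f : ℤ) + 5 * (KS0.R'0N κ Φ (KS.NQ Φ) t p D mk : ℤ) + 3 ≤ (g : ℤ) := by exact_mod_cast hfg
  have hML : (g : ℤ) ≤ ((ML κ Φ t p D g : ℕ) : ℤ) := by exact_mod_cast (ML_le_ML κ Φ t p D g).2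
  have hMLn : ((ML κ Φ t p D g : ℕ) : ℤ) < (nL κ Φ t p D g f : ℤ) := by exact_mod_cast (ML_lt_nL κ Φ t p D g f).1
  have hsL := ML_sub_one_le_kgSL κ Φ t p D g f hN
  have hpr0 : (0 : ℤ) ≤ ((prB0 κ Φ t p D mk : ℕ) : ℤ) := by positivity
  have hR0 : (0 : ℤ) ≤ (KS0.R'0N κ Φ (KS.NQ Φ) t p D mk : ℤ) := by positivity
  have hq0 : (0 : ℤ) ≤ (qx : ℤ) := by positivity
  -- `Z₀ ≥ 2n`, `Z₁ ≥ P + R'`, `(kgNv0+1)·n ≥ n`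
  have hZ₀ : 2 * (nL κ Φ t p D g f : ℤ) ≤ kgZ₀ (nL κ Φ t p D g f) (vL κ Φ t p D g f) (kgR κ Φ t p D mk) 0 (kgq κ Φ t p D g f qx) (kgNv0 κ Φ t p D g f mk qx Wx)
      (kgM₁ (nL κ Φ t p D g f) (ℓL κ Φ t p D g f) (hL κ Φ t p D g f) (kgR κ Φ t p D mk) 0 (kgW κ Φ t p D g f Wx) (kgNv0 κ Φ t p D g f mk qx Wx))
      (kgM₂ (nL κ Φ t p D g f) (ℓL κ Φ t p D g f) (hL κ Φ t p D g f) (vL κ Φ t p D g f) (kgR κ Φ t p D mk) 0 (kgq κ Φ t p D g f qx) (kgW κ Φ t p D g f Wx) (kgNv0 κ Φ t p D g f mk qx Wx)) := by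
    unfold Skelφ.kgZ₀
    have : (0 : ℤ) ≤ (((kgR κ Φ t p D mk) : ℕ) : ℤ) := by positivity
    have hv := abs_nonneg (vL κ Φ t p D g f)
    push_cast; nlinarith
  have hU0 : (0 : ℤ) < (shearUnit (nL κ Φ t p D g f) (hL κ Φ t p D g f) : ℤ) := Skelφ.shearUnit_pos hn1 _
  have hZ₁ : (((kgR κ Φ t p D mk) : ℕ) : ℤ) + ((nL κ Φ t p D g f : ℤ) * (ℓL κ Φ t p D g f : ℤ) / (shearUnit (nL κ Φ t p D g f) (hL κ Φ t p D g f) : ℤ) + 1) ≤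
      kgZ₁ (nL κ Φ t p D g f) (ℓL κ Φ t p D g f) (hL κ Φ t p D g f) (kgR κ Φ t p D mk) 0 (kgW κ Φ t p D g f Wx) (kgNv0 κ Φ t p D g f mk qx Wx)
      (kgM₁ (nL κ Φ t p D g f) (ℓL κ Φ t p D g f) (hL κ Φ t p D g f) (kgR κ Φ t p D mk) 0 (kgW κ Φ t p D g f Wx) (kgNv0 κ Φ t p D g f mk qx Wx))
      (kgWm₂ (nL κ Φ t p D g f) (ℓL κ Φ t p D g f) (hL κ Φ t p D g f) (kgR κ Φ t p D mk) 0 (kgW κ Φ t p D g f Wx) (kgNv0 κ Φ t p D g f mk qx Wx))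
      (kgWp₂ (nL κ Φ t p D g f) (ℓL κ Φ t p D g f) (hL κ Φ t p D g f) (kgR κ Φ t p D mk) 0 (kgW κ Φ t p D g f Wx) (kgNv0 κ Φ t p D g f mk qx Wx))
      (kgM₂ (nL κ Φ t p D g f) (ℓL κ Φ t p D g f) (hL κ Φ t p D g f) (vL κ Φ t p D g f) (kgR κ Φ t p D mk) 0 (kgq κ Φ t p D g f qx) (kgW κ Φ t p D g f Wx) (kgNv0 κ Φ t p D g f mk qx Wx)) := by
    have hL3 : (nL κ Φ t p D g f : ℤ) * (ℓL κ Φ t p D g f : ℤ) / (shearUnit (nL κ Φ t p D g f) (hL κ Φ t p D g f) : ℤ) ≤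
        3 * ((nL κ Φ t p D g f : ℤ) * (ℓL κ Φ t p D g f : ℤ)) / (shearUnit (nL κ Φ t p D g f) (hL κ Φ t p D g f) : ℤ) :=
      Int.ediv_le_ediv hU0 (by linarith [(by positivity : (0 : ℤ) ≤ (nL κ Φ t p D g f : ℤ) * (ℓL κ Φ t p D g f : ℤ))])
    unfold Skelφ.kgZ₁
    push_cast
    have h1 : (0 : ℤ) ≤ ((Skelφ.kgA₁ (nL κ Φ t p D g f) (ℓL κ Φ t p D g f) (hL κ Φ t p D g f) (kgR κ Φ t p D mk) (kgW κ Φ t p D g f Wx) (kgNv0 κ Φ t p D g f mk qx Wx) : ℕ) : ℤ) := by positivity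
    have h2 : (0 : ℤ) ≤ (nL κ Φ t p D g f : ℤ) * (ℓL κ Φ t p D g f : ℤ) / (shearUnit (nL κ Φ t p D g f) (hL κ Φ t p D g f) : ℤ) :=
      Int.ediv_nonneg (by positivity) hU0.le
    have h3 : (0 : ℤ) ≤ (((kgR κ Φ t p D mk) : ℕ) : ℤ) := by positivity
    have h4 : (0 : ℤ) ≤ ((kgWm₂ (nL κ Φ t p D g f) (ℓL κ Φ t p D g f) (hL κ Φ t p D g f) (kgR κ Φ t p D mk) 0 (kgW κ Φ t p D g f Wx) (kgNv0 κ Φ t p D g f mk qx Wx) : ℕ) : ℤ) := by positivity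
    have h5 : (0 : ℤ) ≤ ((kgWp₂ (nL κ Φ t p D g f) (ℓL κ Φ t p D g f) (hL κ Φ t p D g f) (kgR κ Φ t p D mk) 0 (kgW κ Φ t p D g f Wx) (kgNv0 κ Φ t p D g f mk qx Wx) : ℕ) : ℤ) := by positivity
    have h6 : (0 : ℤ) ≤ (((kgM₁ (nL κ Φ t p D g f) (ℓL κ Φ t p D g f) (hL κ Φ t p D g f) (kgR κ Φ t p D mk) 0 (kgW κ Φ t p D g f Wx) (kgNv0 κ Φ t p D g f mk qx Wx) : ℕ) : ℤ) +
        (kgM₂ (nL κ Φ t p D g f) (ℓL κ Φ t p D g f) (hL κ Φ t p D g f) (vL κ Φ t p D g f) (kgR κ Φ t p D mk) 0 (kgq κ Φ t p D g f qx) (kgW κ Φ t p D g f Wx) (kgNv0 κ Φ t p D g f mk qx Wx) : ℕ) + 2) *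
        ((((kgR κ Φ t p D mk) : ℕ) : ℤ) + 0) := by positivity
    linarith
  have hkgR : (((kgR κ Φ t p D mk) : ℕ) : ℤ) = (KS0.R'0N κ Φ (KS.NQ Φ) t p D mk : ℤ) := by rfl
  have hNn : (nL κ Φ t p D g f : ℤ) ≤ ((((kgNv0 κ Φ t p D g f mk qx Wx) : ℕ) : ℤ) + 1) * (nL κ Φ t p D g f : ℤ) := by
    have : (0 : ℤ) ≤ (((kgNv0 κ Φ t p D g f mk qx Wx) : ℕ) : ℤ) := by positivity
    nlinarith
  -- the run coordinates of `w`: `x = φ' w 0 − φ' t 0`, `rows = ⌊(n·Δy − h·Δx)/U⌋`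
  have hUeq : (shearUnit (nL κ Φ t p D g f) (hL κ Φ t p D g f) : ℤ) = (nL κ Φ t p D g f : ℤ) + |hL κ Φ t p D g f| := by
    unfold Skelφ.shearUnit; push_cast [Int.natCast_natAbs]; rfl
  -- the sheared coordinate `s = n·(Δy − h) − h·(Δx − n)` is in `[−U·e, nℓ + U·e]`, `e := R' + pr`
  have habs := abs_nonneg (hL κ Φ t p D g f)
  obtain ⟨hh1, hh2⟩ := abs_le.1 (le_refl |hL κ Φ t p D g f|)
  have hdx : |φ' w 0 - φ' t 0 - (nL κ Φ t p D g f : ℤ)| ≤ (KS0.R'0N κ Φ (KS.NQ Φ) t p D mk : ℤ) + (prB0 κ Φ t p D mk : ℕ) := by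
    rw [abs_le]; constructor <;> linarith
  have hp1 : |hL κ Φ t p D g f * (φ' w 0 - φ' t 0 - (nL κ Φ t p D g f : ℤ))| ≤ |hL κ Φ t p D g f| * ((KS0.R'0N κ Φ (KS.NQ Φ) t p D mk : ℤ) + (prB0 κ Φ t p D mk : ℕ)) := by
    rw [abs_mul]; exact mul_le_mul_of_nonneg_left hdx habs
  obtain ⟨hp1a, hp1b⟩ := abs_le.1 hp1
  have eS : (nL κ Φ t p D g f : ℤ) * (φ' w 1 - φ' t 1) - hL κ Φ t p D g f * (φ' w 0 - φ' t 0) =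
      (nL κ Φ t p D g f : ℤ) * (φ' w 1 - φ' t 1 - hL κ Φ t p D g f) - hL κ Φ t p D g f * (φ' w 0 - φ' t 0 - (nL κ Φ t p D g f : ℤ)) := by ring
  have hslo : -((shearUnit (nL κ Φ t p D g f) (hL κ Φ t p D g f) : ℤ) * ((KS0.R'0N κ Φ (KS.NQ Φ) t p D mk : ℤ) + (prB0 κ Φ t p D mk : ℕ))) ≤
      (nL κ Φ t p D g f : ℤ) * (φ' w 1 - φ' t 1) - hL κ Φ t p D g f * (φ' w 0 - φ' t 0) := by
    rw [eS, hUeq]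
    have : (nL κ Φ t p D g f : ℤ) * (-( (KS0.R'0N κ Φ (KS.NQ Φ) t p D mk : ℤ) + (prB0 κ Φ t p D mk : ℕ))) ≤ (nL κ Φ t p D g f : ℤ) * (φ' w 1 - φ' t 1 - hL κ Φ t p D g f) :=
      mul_le_mul_of_nonneg_left (by linarith) hn0.le
    nlinarith
  have hshi : (nL κ Φ t p D g f : ℤ) * (φ' w 1 - φ' t 1) - hL κ Φ t p D g f * (φ' w 0 - φ' t 0) ≤
      (nL κ Φ t p D g f : ℤ) * (ℓL κ Φ t p D g f) + (shearUnit (nL κ Φ t p D g f) (hL κ Φ t p D g f) : ℤ) * ((KS0.R'0N κ Φ (KS.NQ Φ) t p D mk : ℤ) + (prB0 κ Φ t p D mk : ℕ)) := by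
    rw [eS, hUeq]
    have : (nL κ Φ t p D g f : ℤ) * (φ' w 1 - φ' t 1 - hL κ Φ t p D g f) ≤ (nL κ Φ t p D g f : ℤ) * ((ℓL κ Φ t p D g f : ℤ) + ((KS0.R'0N κ Φ (KS.NQ Φ) t p D mk : ℤ) + (prB0 κ Φ t p D mk : ℕ))) :=
      mul_le_mul_of_nonneg_left (by linarith) hn0.le
    nlinarith
  -- rows bounds by integer division
  have hrlo : -((KS0.R'0N κ Φ (KS.NQ Φ) t p D mk : ℤ) + (prB0 κ Φ t p D mk : ℕ)) ≤
      ((nL κ Φ t p D g f : ℤ) * (φ' w 1 - φ' t 1) - hL κ Φ t p D g f * (φ' w 0 - φ' t 0)) / (shearUnit (nL κ Φ t p D g f) (hL κ Φ t p D g f) : ℤ) := by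
    have h := Int.ediv_le_ediv hU0 hslo
    have e : -((shearUnit (nL κ Φ t p D g f) (hL κ Φ t p D g f) : ℤ) * ((KS0.R'0N κ Φ (KS.NQ Φ) t p D mk : ℤ) + (prB0 κ Φ t p D mk : ℕ))) =
        (-((KS0.R'0N κ Φ (KS.NQ Φ) t p D mk : ℤ) + (prB0 κ Φ t p D mk : ℕ))) * (shearUnit (nL κ Φ t p D g f) (hL κ Φ t p D g f) : ℤ) := by ring
    rw [e, Int.mul_ediv_cancel _ (ne_of_gt hU0)] at h
    exact h
  have hrhi : ((nL κ Φ t p D g f : ℤ) * (φ' w 1 - φ' t 1) - hL κ Φ t p D g f * (φ' w 0 - φ' t 0)) / (shearUnit (nL κ Φ t p D g f) (hL κ Φ t p D g f) : ℤ) ≤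
      (nL κ Φ t p D g f : ℤ) * (ℓL κ Φ t p D g f) / (shearUnit (nL κ Φ t p D g f) (hL κ Φ t p D g f) : ℕ) + ((KS0.R'0N κ Φ (KS.NQ Φ) t p D mk : ℤ) + (prB0 κ Φ t p D mk : ℕ)) := by
    have h := Int.ediv_le_ediv hU0 hshi
    rw [Int.add_mul_ediv_left _ _ (ne_of_gt hU0)] at h
    exact h
  -- assemble
  have hP0 : (0 : ℤ) ≤ (nL κ Φ t p D g f : ℤ) * (ℓL κ Φ t p D g f : ℤ) / (shearUnit (nL κ Φ t p D g f) (hL κ Φ t p D g f) : ℤ) :=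
    Int.ediv_nonneg (by positivity) hU0.le
  have hkR0 : (0 : ℤ) ≤ (((kgR κ Φ t p D mk) : ℕ) : ℤ) := by positivity
  rw [Finset.mem_Icc, Pi.le_def, Pi.le_def, Fin.forall_fin_two, Fin.forall_fin_two]
  simp only [Skelφ.runX_zero, Skelφ.runX_one, Skelφ.shearCoord_apply, Skelφ.relCoord_apply, one_mul]
  refine ⟨⟨by linarith, ?_⟩, by nlinarith, ?_⟩
  · linarith
  · linarith

/-! ## §3 The last core in the widened arrival box -/

set_option maxHeartbeats 1600000 in
/-- **The root corridor's last core, read in the `t`-frame, lies in any box `[lo′, hi′]` enclosing `[kgLastLo(kgNv0) − (3n_L, 2sL), kgLastHi(kgNv0) + (3n_L, 1)]`**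
(`rootBoxX_R` + the row shift). [this work] -/
theorem rootLast_mem_box (κ : Consts) {V : Type} [DecidableEq V] [Countable V] {G : SimpleGraph V} [G.LocallyFinite] (Φ : PlanarSkeletonFrmQuasi G) (t : V) (p : unitInterval) (D : Skelφ.StepI.DataNS V) (mk : ℕ) (g : ℕ) (f : ℕ) (qx : ℕ) (Wx : ℕ) (hN : EqNumL κ Φ t p D g f) (hg : gFloorKG κ Φ t p D mk ≤ g) (hg2 : 40 * Neg.K κ * KS0.R'0N κ Φ (KS.NQ Φ) t p D mk ≤ g)
    (hqx : qx ≤ 100 * nL κ Φ t p D g f) (hWx : (Wx : ℤ) ≤ 20 * (kgSL (nL κ Φ t p D g f) (ℓL κ Φ t p D g f) (hL κ Φ t p D g f))) (hf : KS.fxR0 κ Φ t p D mk ≤ f)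
    (h0C : (kgFar (nL κ Φ t p D g f) (ℓL κ Φ t p D g f) (hL κ Φ t p D g f) (vL κ Φ t p D g f) (kgR κ Φ t p D mk) 0 (kgq κ Φ t p D g f qx) (kgW κ Φ t p D g f Wx) 0) ≤ (kgTgt0 κ Φ t p D g f mk))
    {φ' : V → Site 2} {c₁ : V} (hX : φ' c₁ 0 - φ' t 0 = (X1 κ Φ t p D mk g f (kgq κ Φ t p D g f qx))) (hY : φ' c₁ 1 - φ' t 1 = (Y1s κ Φ t p D mk g f (kgq κ Φ t p D g f qx)))
    {lo hi : Site 2}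
    (hlo0 : lo 0 ≤ ((kgRows0_of κ Φ t p D g f mk qx Wx hN hg).kgLastLo (kgNv0 κ Φ t p D g f mk qx Wx)) 0 - 3 * (nL κ Φ t p D g f : ℤ))
    (hhi0 : ((kgRows0_of κ Φ t p D g f mk qx Wx hN hg).kgLastHi (kgNv0 κ Φ t p D g f mk qx Wx)) 0 + 3 * (nL κ Φ t p D g f : ℤ) ≤ hi 0)
    (hlo1 : lo 1 ≤ ((kgRows0_of κ Φ t p D g f mk qx Wx hN hg).kgLastLo (kgNv0 κ Φ t p D g f mk qx Wx)) 1 - 2 * (kgSL (nL κ Φ t p D g f) (ℓL κ Φ t p D g f) (hL κ Φ t p D g f)))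
    (hhi1 : ((kgRows0_of κ Φ t p D g f mk qx Wx hN hg).kgLastHi (kgNv0 κ Φ t p D g f mk qx Wx)) 1 + 1 ≤ hi 1)
    {w : V} (hw : Skelφ.runX φ' c₁ (nL κ Φ t p D g f) (hL κ Φ t p D g f) 1 w ∈ ScheduleNP.core (Skelφ.kgCorrSched ((kgRows0_of κ Φ t p D g f mk qx Wx hN hg).kgVals_ok₁ (KS.kgNR κ Φ t p D mk g f qx Wx)) ((kgRows0_of κ Φ t p D g f mk qx Wx hN hg).kgVals_ok₂ (KS.kgNR κ Φ t p D mk g f qx Wx)) ((kgRows0_of κ Φ t p D g f mk qx Wx hN hg).kgVals_split (KS.kgNR κ Φ t p D mk g f qx Wx))) ((Skelφ.kgCorrSched ((kgRows0_of κ Φ t p D g f mk qx Wx hN hg).kgVals_ok₁ (KS.kgNR κ Φ t p D mk g f qx Wx)) ((kgRows0_of κ Φ t p D g f mk qx Wx hN hg).kgVals_ok₂ (KS.kgNR κ Φ t p D mk g f qx Wx)) ((kgRows0_of κ Φ t p D g f mk qx Wx hN hg).kgVals_split (KS.kgNR κ Φ t p D mk g f qx Wx))).N + 1)) :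
    Skelφ.runX φ' t (nL κ Φ t p D g f) (hL κ Φ t p D g f) 1 w ∈ Finset.Icc lo hi := by
  have H := kgRows0_of κ Φ t p D g f mk qx Wx hN hg
  have hn1 := (one_le_of_eqNumL κ Φ t p D g f hN).1
  have hlast := H.mem_Icc_of_mem_last (KS.kgNR κ Φ t p D mk g f qx Wx) hw
  obtain ⟨b0, b1, b2, b3⟩ := rootBoxX_R κ Φ t p D mk g f qx Wx hN hg hg2 hqx hWx hf h0C
  obtain ⟨hr0, hrn, -⟩ := rows_c₁s_zero κ Φ t p D mk g f (kgq κ Φ t p D g f qx) hN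
  have hU : (nL κ Φ t p D g f : ℤ) ≤ (shearUnit (nL κ Φ t p D g f) (hL κ Φ t p D g f) : ℤ) := by
    unfold Skelφ.shearUnit; push_cast; linarith [abs_nonneg (hL κ Φ t p D g f), (Int.natCast_natAbs (hL κ Φ t p D g f)).le]
  have hsh := Skelφ.runX_shift_mem_Icc t c₁ (nL κ Φ t p D g f) hn1 (hL κ Φ t p D g f) hX hY hr0 (lt_of_lt_of_le hrn hU) hlast
  rw [Finset.mem_Icc, Pi.le_def, Pi.le_def, Fin.forall_fin_two, Fin.forall_fin_two] at hsh ⊢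
  simp only [Pi.add_apply, Matrix.cons_val_zero, Matrix.cons_val_one, Matrix.cons_val_fin_one] at hsh
  obtain ⟨⟨h0, h1⟩, h2, h3⟩ := hsh
  refine ⟨⟨by linarith, by linarith⟩, by linarith, by linarith⟩

end ReadX

end KS

end NegB

end PlanarSkeletonFrmQuasi

end Summit.CriticalPhenomena.PercolationContinuityZ3.Theorems.Transplant

end
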